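import Summits.AtomisticToContinuum.Crystallization.Theorems.PerronTransitivityUniformBindingRigidityCohesionM

/-!
# Cohesion of uniformly bound Lennard-Jones configurations, XIX: the credited sharp tail

Helper file (`--supports stmt-AtomisticToContinuum-15099`) of the registered stub
`stub_localHalfSpaceCert` (= `(LOCAL)`, skeleton rev 6: separation `31/50`, radius `6`, level
`−711/500`) and of the successors of `stub_sepThirtyOne` (the separation bootstrap) of the line
`registered` of the crux
`Summit.AtomisticToContinuum.Crystallization.Theses.PerronTransitivity.UniformBindingRigidity`
(item stmt-AtomisticToContinuum-15099).  Notation: `U_Y(p) = Σ'_{q ∈ Y, q ≠ p} V_LJ(dist p q)`,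
`g_δ(t) = (2t/δ + 1)³` (the tree's packing count `ncard_ball_le`), the sharp tail
`T(δ, R) = 16/(δ³R³) + 18/(δ²R⁴) + 36/(5δR⁵) + 1/R⁶` of part XIII, and the NEAR SET
`N = {q ∈ Y ∖ {p} : dist q p ≤ R}` of a site `p ∈ Y` at truncation radius `R`.

Part XIII's discrete layer-cake summation `sum_inv_pow_six_le_sharp_aux` carries an OFFSET `m`:
if `m ≤ g_δ(R)` and `m + #{q' far : d(q') ≤ d(q)} ≤ g_δ(d(q))` at every far point `q`, then
`m R⁻⁶ + Σ_far d(q)⁻⁶ ≤ T(δ, R)`.  Parts XIII/XIV use it with `m = 0` only.  But the `#N + 1` points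
of `Y` in the truncation ball (the near set and the centre) are counted by `g_δ` as well, so
`m = #N + 1` is admissible — this is the CREDIT `(#N + 1) R⁻⁶`, free information:

* §33 `sum_inv_pow_six_le_credit`: `(#N + 1) R⁻⁶ + Σ_{q ∈ s} d(q)⁻⁶ ≤ T(δ, R)` for every finite
  set `s` of points of `Y` at distance `> R` from `p` (general form
  `card_mul_add_sum_inv_pow_six_le_sharp`: any finite `N' ⊆ Y ∩ closedBall p R` in place of
  `insert p N`), and its `tsum` form `summable_and_tsum_inv_pow_six_far_le_credit`;
* §34 the CREDITED TRUNCATION `sum_near_sub_creditTail_le_tsum`: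

    `Σ_{q ∈ N} V_LJ(dist p q) − (1/6)(T(δ, R) − (#N + 1) R⁻⁶) ≤ U_Y(p)`

  (part XIV's `sum_near_sub_sharpTail_le_tsum` had the allowance `T(δ, R)/6`), via the credited
  Lennard-Jones far tail `summable_and_neg_creditTail_le_tsum_far` (`V_LJ ≥ −r⁻⁶/6`), and the
  credited single-site bound `neg_tsum_le_card_add_creditTail`:
  `−U_Y(p) ≤ (1/12 − R⁻⁶/6)·#N + (T(δ, R) − R⁻⁶)/6`.

* §35 the CREDITED FINITE-CERTIFICATE REDUCTION `local_of_finiteCert_credit_at` (parameters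
  `δ, r, Λ, R'`, as in part XVI) and its instance `local_thirtyOne_of_finiteCert_credit` at
  `(31/50, 6, −711/500)`, whose conclusion is literally the rev-6 stub.

So in the single-site separation bootstrap every near point now costs `1/12 − R⁻⁶/6` instead of
`1/12` (at the bootstrap radius `R = 13/10`: `0.0488…` instead of `0.0833…`), which moves the
fixed point of the bootstrap of part XV from `≈ 0.627` (rung `31/50`) to `≈ 0.646` (next rung
`16/25`), and every finite-certificate allowance `T(δ, R')/6` of parts XIV/XVI drops by
`(#N + 1) R'⁻⁶/6`.  All `[folklore]`.
-/

noncomputable section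

namespace Summit.AtomisticToContinuum.Crystallization.Theorems.PerronTransitivityUniformBindingRigidity

open scoped BigOperators Topology
open Filter Set Metric
open Literature.MathematicalPhysics.StatisticalMechanics
open Summit.AtomisticToContinuum.Crystallization.Theorems.ChargedEnergyGapNegative (E3)
open Summit.AtomisticToContinuum.Crystallization.Theorems.HullBulkOptimal
  (tsum_finite_eq_sum ncard_ball_le)

/-! ## §33 The credited layer-cake summation -/

section Credit

variable {Y : Set E3} {δ : ℝ}

/-- **Credited sixth-power sum, general form.** For a `δ`-separated `Y`, any centre `p`, `R > 0`,
a finite set `N'` of points of `Y` within distance `R` of `p` and a finite set `s` of points of `Y`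
at distance `> R` from `p`: `#N' · R⁻⁶ + Σ_{q ∈ s} (dist q p)⁻⁶ ≤ T(δ, R)` — the layer-cake
summation `sum_inv_pow_six_le_sharp_aux` with offset `m = #N'`: `N'` and `{q' ∈ s : d(q') ≤ d(q)}`
are disjoint parts of `Y ∩ closedBall p d(q)`, counted together by `ncard_ball_le`. [folklore] -/
theorem card_mul_add_sum_inv_pow_six_le_sharp (hδ : 0 < δ)
    (hsep : ∀ a ∈ Y, ∀ b ∈ Y, a ≠ b → δ ≤ dist a b) (p : E3) {R : ℝ} (hR : 0 < R)
    (N' : Finset E3) (hN' : ∀ q ∈ N', q ∈ Y ∧ dist q p ≤ R)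
    (s : Finset E3) (hs : ∀ q ∈ s, q ∈ Y ∧ R < dist q p) :
    (N'.card : ℝ) * R⁻¹ ^ 6 + ∑ q ∈ s, (dist q p)⁻¹ ^ 6 ≤
      16 / (δ ^ 3 * R ^ 3) + 18 / (δ ^ 2 * R ^ 4) + 36 / (5 * δ * R ^ 5) + 1 / R ^ 6 := by
  classical
  -- packing count of a finite set of points of `Y` within `t` of `p`
  have hpack : ∀ (A : Finset E3) (t : ℝ), 0 ≤ t → (∀ q ∈ A, q ∈ Y ∧ dist q p ≤ t) →
      (A.card : ℝ) ≤ (2 * t / δ + 1) ^ 3 := by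
    intro A t ht hA
    have hfin := finite_sep_ball hδ hsep p t
    have hsub : (A : Set E3) ⊆ {y : E3 | y ∈ Y ∧ dist y p ≤ t} := fun y hy => hA y hy
    have h1 : (A.card : ℝ) ≤ (({y : E3 | y ∈ Y ∧ dist y p ≤ t} : Set E3).ncard : ℝ) := by
      exact_mod_cast (Set.ncard_coe_finset A).symm.le.trans (Set.ncard_le_ncard hsub hfin)
    exact h1.trans (ncard_ball_le hδ hsep p ht)
  have hm : (N'.card : ℝ) ≤ (2 * R / δ + 1) ^ 3 := hpack N' R hR.le hN'
  have hcount : ∀ q ∈ s, (N'.card : ℝ) + ((s.filter fun q' => dist q' p ≤ dist q p).card : ℝ) ≤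
      (2 * dist q p / δ + 1) ^ 3 := by
    intro q hq
    have hdisj : Disjoint N' (s.filter fun q' => dist q' p ≤ dist q p) := by
      rw [Finset.disjoint_left]
      intro y hyN hys
      exact absurd (hN' y hyN).2 (not_le.2 (hs y (Finset.mem_filter.1 hys).1).2)
    have hA : ∀ y ∈ N' ∪ s.filter (fun q' => dist q' p ≤ dist q p),
        y ∈ Y ∧ dist y p ≤ dist q p := by
      intro y hy
      rcases Finset.mem_union.1 hy with hy | hy
      · exact ⟨(hN' y hy).1, (hN' y hy).2.trans (hs q hq).2.le⟩
      · exact ⟨(hs y (Finset.mem_filter.1 hy).1).1, (Finset.mem_filter.1 hy).2⟩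
    have h := hpack _ (dist q p) dist_nonneg hA
    rw [Finset.card_union_of_disjoint hdisj] at h
    exact_mod_cast h
  exact sum_inv_pow_six_le_sharp_aux hδ p s.card s N'.card R rfl hR hm
    (fun q hq => (hs q hq).2.le) hcount

/-- **Credited sixth-power sum over finitely many far points.** For a `δ`-separated `Y ∋ p`,
`R > 0`, the near set `N = {q ∈ Y ∖ {p} : dist q p ≤ R}` and a finite set `s` of points of `Y` at
distance `> R` from `p`: `(#N + 1) R⁻⁶ + Σ_{q ∈ s} (dist q p)⁻⁶ ≤ T(δ, R)`
(`card_mul_add_sum_inv_pow_six_le_sharp` with `N' = insert p N`).  Part XIII's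
`sum_inv_pow_six_le_sharp` is the case without credit. [folklore] -/
theorem sum_inv_pow_six_le_credit (hδ : 0 < δ)
    (hsep : ∀ a ∈ Y, ∀ b ∈ Y, a ≠ b → δ ≤ dist a b) {p : E3} (hp : p ∈ Y) {R : ℝ} (hR : 0 < R)
    (N : Finset E3) (hN : ∀ q, q ∈ N ↔ q ∈ Y ∧ q ≠ p ∧ dist q p ≤ R)
    (s : Finset E3) (hs : ∀ q ∈ s, q ∈ Y ∧ R < dist q p) :
    ((N.card : ℝ) + 1) * R⁻¹ ^ 6 + ∑ q ∈ s, (dist q p)⁻¹ ^ 6 ≤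
      16 / (δ ^ 3 * R ^ 3) + 18 / (δ ^ 2 * R ^ 4) + 36 / (5 * δ * R ^ 5) + 1 / R ^ 6 := by
  classical
  have hpN : p ∉ N := fun h => ((hN p).1 h).2.1 rfl
  have hN' : ∀ q ∈ insert p N, q ∈ Y ∧ dist q p ≤ R := by
    intro q hq
    rcases Finset.mem_insert.1 hq with rfl | hq
    · exact ⟨hp, by rw [dist_self]; exact hR.le⟩
    · exact ⟨((hN q).1 hq).1, ((hN q).1 hq).2.2⟩
  have h := card_mul_add_sum_inv_pow_six_le_sharp hδ hsep p hR (insert p N) hN' s hs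
  rw [Finset.card_insert_of_notMem hpN] at h
  push_cast at h
  exact h

/-- **Credited far tail of the sixth-power sum.** For a `δ`-separated `Y ∋ p`, `R > 0`, the near
set `N` and `B ⊆ {q ∈ Y : dist q p > R}`: the family `(dist q p)⁻⁶` is summable on `B` with sum
`≤ T(δ, R) − (#N + 1) R⁻⁶` (all finite partial sums are, by `sum_inv_pow_six_le_credit`).
[folklore] -/
theorem summable_and_tsum_inv_pow_six_far_le_credit (hδ : 0 < δ)
    (hsep : ∀ a ∈ Y, ∀ b ∈ Y, a ≠ b → δ ≤ dist a b) {p : E3} (hp : p ∈ Y) {R : ℝ} (hR : 0 < R)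
    (N : Finset E3) (hN : ∀ q, q ∈ N ↔ q ∈ Y ∧ q ≠ p ∧ dist q p ≤ R) {B : Set E3}
    (hB : B ⊆ {q : E3 | q ∈ Y ∧ R < dist q p}) :
    Summable (fun q : B => (dist (q : E3) p)⁻¹ ^ 6) ∧
      ∑' q : B, (dist (q : E3) p)⁻¹ ^ 6 ≤
        16 / (δ ^ 3 * R ^ 3) + 18 / (δ ^ 2 * R ^ 4) + 36 / (5 * δ * R ^ 5) + 1 / R ^ 6 -
          ((N.card : ℝ) + 1) * R⁻¹ ^ 6 := by
  classical
  have key : ∀ u : Finset B, ∑ q ∈ u, (dist (q : E3) p)⁻¹ ^ 6 ≤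
      16 / (δ ^ 3 * R ^ 3) + 18 / (δ ^ 2 * R ^ 4) + 36 / (5 * δ * R ^ 5) + 1 / R ^ 6 -
        ((N.card : ℝ) + 1) * R⁻¹ ^ 6 := by
    intro u
    have h := sum_inv_pow_six_le_credit hδ hsep hp hR N hN (u.image Subtype.val) fun q hq => by
      obtain ⟨q', -, rfl⟩ := Finset.mem_image.1 hq
      exact hB q'.2
    rw [Finset.sum_image fun a _ b _ h => Subtype.ext h] at h
    linarith
  have hsum : Summable (fun q : B => (dist (q : E3) p)⁻¹ ^ 6) :=
    summable_of_sum_le (fun _ => by positivity) key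
  exact ⟨hsum, Real.tsum_le_of_sum_le (fun _ => by positivity) key⟩

end Credit

/-! ## §34 The credited truncation and single-site bound -/

section Truncation

variable {Y : Set E3} {δ : ℝ}

/-- **Credited far tail of a Lennard-Jones site sum.** For a `δ`-separated `Y ∋ p`, `R > 0`, the
near set `N` and `B ⊆ {q ∈ Y : dist q p > R}`: the family `V_LJ(dist p z)` is summable on `B`
(part XIV) and its sum is `≥ −(T(δ, R) − (#N + 1) R⁻⁶)/6` (`V_LJ ≥ −r⁻⁶/6` and
`summable_and_tsum_inv_pow_six_far_le_credit`). [folklore] -/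
theorem summable_and_neg_creditTail_le_tsum_far (hδ : 0 < δ)
    (hsep : ∀ a ∈ Y, ∀ b ∈ Y, a ≠ b → δ ≤ dist a b) {p : E3} (hp : p ∈ Y) {R : ℝ} (hR : 0 < R)
    (N : Finset E3) (hN : ∀ q, q ∈ N ↔ q ∈ Y ∧ q ≠ p ∧ dist q p ≤ R) {B : Set E3}
    (hB : B ⊆ {q : E3 | q ∈ Y ∧ R < dist q p}) :
    Summable (fun z : B => lennardJones (dist p (z : E3))) ∧
      -(1 / 6 * (16 / (δ ^ 3 * R ^ 3) + 18 / (δ ^ 2 * R ^ 4) + 36 / (5 * δ * R ^ 5) + 1 / R ^ 6 -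
          ((N.card : ℝ) + 1) * R⁻¹ ^ 6)) ≤
        ∑' z : B, lennardJones (dist p (z : E3)) := by
  obtain ⟨hg, hgle⟩ := summable_and_tsum_inv_pow_six_far_le_credit hδ hsep hp hR N hN hB
  have hB' : B ⊆ {q : E3 | q ∈ Y ∧ R ≤ dist q p} := fun q hq => ⟨(hB hq).1, (hB hq).2.le⟩
  obtain ⟨hV, -⟩ := summable_and_neg_sharpTail_le_tsum_far hδ hsep p hR hB'
  refine ⟨hV, ?_⟩
  have h1 : ∑' z : B, -(1 / 6 * (dist (z : E3) p)⁻¹ ^ 6) ≤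
      ∑' z : B, lennardJones (dist p (z : E3)) := by
    refine Summable.tsum_le_tsum (fun z => ?_) (hg.mul_left (1 / 6)).neg hV
    rw [dist_comm p]
    have := ExcessDecayLiouvilleFineGrains.neg_inv_pow_six_le_lennardJones (dist (z : E3) p)
    simpa using this
  rw [tsum_neg, tsum_mul_left] at h1
  nlinarith

/-- **Credited lower truncation.** For a `δ`-separated `Y ∋ p`, `R > 0` and the near set
`N = {q ∈ Y ∖ {p} : dist q p ≤ R}`:
`Σ_{q ∈ N} V_LJ(dist p q) − (1/6)(T(δ, R) − (#N + 1) R⁻⁶) ≤ U_Y(p)` — part XIV's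
`sum_near_sub_sharpTail_le_tsum` (allowance `T(δ, R)/6`) re-run with the credited far tail: split
`U_Y(p)` into the finite near sum and the `tsum` over the far set `{q ∈ Y ∖ {p} : q ∉ N}`, which lies
in `{dist q p > R}`. [folklore] -/
theorem sum_near_sub_creditTail_le_tsum (hδ : 0 < δ)
    (hsep : ∀ a ∈ Y, ∀ b ∈ Y, a ≠ b → δ ≤ dist a b) {p : E3} (hp : p ∈ Y) {R : ℝ} (hR : 0 < R)
    (N : Finset E3) (hN : ∀ q, q ∈ N ↔ q ∈ Y ∧ q ≠ p ∧ dist q p ≤ R) :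
    ∑ q ∈ N, lennardJones (dist p q) -
        1 / 6 * (16 / (δ ^ 3 * R ^ 3) + 18 / (δ ^ 2 * R ^ 4) + 36 / (5 * δ * R ^ 5) + 1 / R ^ 6 -
          ((N.card : ℝ) + 1) * R⁻¹ ^ 6) ≤
      ∑' q : {q : E3 // q ∈ Y ∧ q ≠ p}, lennardJones (dist p q.1) := by
  classical
  set A : Set E3 := {b : E3 | b ∈ Y ∧ b ≠ p ∧ b ∈ N} with hA
  set B : Set E3 := {b : E3 | b ∈ Y ∧ b ≠ p ∧ b ∉ N} with hB
  have hT : ({b : E3 | b ∈ Y ∧ b ≠ p} : Set E3) = A ∪ B := by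
    ext b
    simp only [hA, hB, mem_setOf_eq, mem_union]
    tauto
  have hdisj : Disjoint A B := by
    rw [Set.disjoint_left]
    rintro b ⟨-, -, h1⟩ ⟨-, -, h2⟩
    exact h2 h1
  have hAfin : A.Finite := (N.finite_toSet).subset fun b hb => hb.2.2
  have hAF : hAfin.toFinset = N := by
    ext b
    rw [Set.Finite.mem_toFinset]
    simp only [hA, mem_setOf_eq]
    constructor
    · exact fun h => h.2.2
    · exact fun h => ⟨((hN b).1 h).1, ((hN b).1 h).2.1, h⟩
  set f : E3 → ℝ := fun b => lennardJones (dist p b) with hf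
  have hsA : Summable (f ∘ (↑) : A → ℝ) := by
    haveI := hAfin.to_subtype
    exact Summable.of_finite
  have hBsub : B ⊆ {b : E3 | b ∈ Y ∧ R < dist b p} := by
    rintro b ⟨hb, hbp, hbN⟩
    refine ⟨hb, ?_⟩
    by_contra hle
    exact hbN ((hN b).2 ⟨hb, hbp, not_lt.1 hle⟩)
  obtain ⟨hsB', htail⟩ := summable_and_neg_creditTail_le_tsum_far hδ hsep hp hR N hN hBsub
  have hsB : Summable (f ∘ (↑) : B → ℝ) := hsB'
  have h0 : (∑' b : {b : E3 // b ∈ Y ∧ b ≠ p}, lennardJones (dist p b.1)) =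
      ∑' b : ↥({b : E3 | b ∈ Y ∧ b ≠ p} : Set E3), f b := rfl
  have hsplit : ∑' b : {b : E3 // b ∈ Y ∧ b ≠ p}, lennardJones (dist p b.1) =
      ∑' b : A, f b + ∑' b : B, f b := by
    rw [h0, tsum_congr_set_coe f hT]
    exact Summable.tsum_union_disjoint hdisj hsA hsB
  have hfinsum : ∑' b : A, f b = ∑ b ∈ N, lennardJones (dist p b) := by
    rw [← hAF]
    exact tsum_finite_eq_sum hAfin f
  have htail' : -(1 / 6 * (16 / (δ ^ 3 * R ^ 3) + 18 / (δ ^ 2 * R ^ 4) + 36 / (5 * δ * R ^ 5) +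
      1 / R ^ 6 - ((N.card : ℝ) + 1) * R⁻¹ ^ 6)) ≤ ∑' b : B, f b := htail
  rw [hsplit, hfinsum]
  linarith

/-- **Credited single-site binding bound.** For a `δ`-separated `Y ∋ p`, `R > 0` and the near
set `N`: `−U_Y(p) ≤ (1/12 − R⁻⁶/6)·#N + (T(δ, R) − R⁻⁶)/6` — every near point costs
`1/12 − R⁻⁶/6` (its term is `≥ −1/12`, its credit is `R⁻⁶/6`), against `1/12` in part XIV's
`neg_tsum_le_card_add_sharpTail`. [folklore] -/
theorem neg_tsum_le_card_add_creditTail (hδ : 0 < δ)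
    (hsep : ∀ a ∈ Y, ∀ b ∈ Y, a ≠ b → δ ≤ dist a b) {p : E3} (hp : p ∈ Y) {R : ℝ} (hR : 0 < R)
    (N : Finset E3) (hN : ∀ q, q ∈ N ↔ q ∈ Y ∧ q ≠ p ∧ dist q p ≤ R) :
    -(∑' q : {q : E3 // q ∈ Y ∧ q ≠ p}, lennardJones (dist p q.1)) ≤
      (1 / 12 - 1 / 6 * R⁻¹ ^ 6) * (N.card : ℝ) +
        1 / 6 * (16 / (δ ^ 3 * R ^ 3) + 18 / (δ ^ 2 * R ^ 4) + 36 / (5 * δ * R ^ 5) + 1 / R ^ 6 -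
          R⁻¹ ^ 6) := by
  have h1 := sum_near_sub_creditTail_le_tsum hδ hsep hp hR N hN
  have h2 := neg_card_div_le_sum_lennardJones N fun q => dist p q
  linarith

end Truncation

/-! ## §35 The credited finite-certificate reduction -/

/-- **`LOCAL(δ, r, Λ)` from a CREDITED finite certificate.** Let `δ > 0`, `r ≥ 0`, `R' > 0`.  If
every finite `δ`-separated half-space cluster `F ∋ 0` (`{⟪·, u⟫ ≤ 0}`, `‖u‖ = 1`) within `r + R'`
of `0` has a site `p`, `dist p 0 ≤ r`, whose truncated cluster sum over its near set `N` in `F`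
exceeds `Λ + (1/6)(T(δ, R') − (#N + 1) R'⁻⁶)`, then no `δ`-separated `Y ∋ 0` in a closed half-space
through `0` has all its sites within `r` of `0` bound `≤ Λ` — part XVI's
`stub_local_of_finiteCert_at` with the credited truncation `sum_near_sub_creditTail_le_tsum`
(`F = Y ∩ closedBall 0 (r + R')`; the near set of the certified site in `Y` is its near set in `F`).
[folklore] -/
theorem local_of_finiteCert_credit_at {δ r Λ R' : ℝ} (hδ : 0 < δ) (hr : 0 ≤ r) (hR' : 0 < R')
    (hcert : ∀ (F : Finset E3) (u : E3), ‖u‖ = 1 → (0 : E3) ∈ F →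
      (∀ a ∈ F, ∀ b ∈ F, a ≠ b → δ ≤ dist a b) → (∀ a ∈ F, inner ℝ a u ≤ 0) →
      (∀ a ∈ F, dist a 0 ≤ r + R') →
      ∃ p ∈ F, dist p 0 ≤ r ∧ ∀ N : Finset E3,
        (∀ q, q ∈ N ↔ q ∈ F ∧ q ≠ p ∧ dist q p ≤ R') →
          Λ + 1 / 6 * (16 / (δ ^ 3 * R' ^ 3) + 18 / (δ ^ 2 * R' ^ 4) + 36 / (5 * δ * R' ^ 5) +
              1 / R' ^ 6 - ((N.card : ℝ) + 1) * R'⁻¹ ^ 6) <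
            ∑ q ∈ N, lennardJones (dist p q))
    (Y : Set E3) (u : E3) (hu : ‖u‖ = 1) (h0 : (0 : E3) ∈ Y)
    (hsep : ∀ p ∈ Y, ∀ q ∈ Y, p ≠ q → δ ≤ dist p q) (hhalf : ∀ q ∈ Y, inner ℝ q u ≤ 0)
    (hU : ∀ p ∈ Y, dist p 0 ≤ r →
      ∑' q : {q : E3 // q ∈ Y ∧ q ≠ p}, lennardJones (dist p q.1) ≤ Λ) :
    False := by
  -- the finite cluster `F = Y ∩ closedBall 0 (r + R')`
  have hfin := finite_sep_ball hδ hsep (0 : E3) (r + R')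
  set F : Finset E3 := hfin.toFinset with hFdef
  have hF : ∀ z, z ∈ F ↔ z ∈ Y ∧ dist z 0 ≤ r + R' := fun z => by
    rw [hFdef, Set.Finite.mem_toFinset]; rfl
  have h0F : (0 : E3) ∈ F := (hF 0).2 ⟨h0, by rw [dist_self]; linarith⟩
  obtain ⟨p, hpF, hpr, hcertp⟩ := hcert F u hu h0F
    (fun a ha b hb hab => hsep a ((hF a).1 ha).1 b ((hF b).1 hb).1 hab)
    (fun a ha => hhalf a ((hF a).1 ha).1) (fun a ha => ((hF a).1 ha).2)
  have hp : p ∈ Y := ((hF p).1 hpF).1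
  -- the near set of `p` in `Y` is its near set in `F`
  obtain ⟨N, hN⟩ := exists_finset_near hδ hsep p R'
  have hN' : ∀ q, q ∈ N ↔ q ∈ F ∧ q ≠ p ∧ dist q p ≤ R' := by
    intro q
    rw [hN, hF]
    constructor
    · rintro ⟨hq, hqp, hd⟩
      exact ⟨⟨hq, by linarith [dist_triangle q p 0]⟩, hqp, hd⟩
    · rintro ⟨⟨hq, -⟩, hqp, hd⟩
      exact ⟨hq, hqp, hd⟩
  have h1 := sum_near_sub_creditTail_le_tsum hδ hsep hp hR' N hN
  have h2 := hcertp N hN'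
  have h3 := hU p hp hpr
  linarith

/-- **The rev-6 `(LOCAL)` at separation `31/50` from a CREDITED finite certificate.** The instance
`(δ, r, Λ) = (31/50, 6, −711/500)` of `local_of_finiteCert_credit_at`: if for some `R' > 0` every
finite `31/50`-separated `F ∋ 0` in `{⟪·, u⟫ ≤ 0} ∩ closedBall 0 (6 + R')` has a site `p`,
`dist p 0 ≤ 6`, with `−711/500 + (1/6)(T(31/50, R') − (#N + 1) R'⁻⁶) < Σ_{q ∈ N} V_LJ(dist p q)`
over its near set `N = {q ∈ F ∖ {p} : dist q p ≤ R'}`, then the registered signature of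
`stub_localHalfSpaceCert` (skeleton rev 6) holds literally. [folklore] -/
theorem local_thirtyOne_of_finiteCert_credit
    (H : ∃ R' : ℝ, 0 < R' ∧
      ∀ (F : Finset (EuclideanSpace ℝ (Fin 3))) (u : EuclideanSpace ℝ (Fin 3)), ‖u‖ = 1 →
        (0 : EuclideanSpace ℝ (Fin 3)) ∈ F →
        (∀ a ∈ F, ∀ b ∈ F, a ≠ b → 31 / 50 ≤ dist a b) →
        (∀ a ∈ F, inner ℝ a u ≤ 0) →
        (∀ a ∈ F, dist a 0 ≤ 6 + R') →
        ∃ p ∈ F, dist p 0 ≤ 6 ∧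
          ∀ N : Finset (EuclideanSpace ℝ (Fin 3)),
            (∀ q, q ∈ N ↔ q ∈ F ∧ q ≠ p ∧ dist q p ≤ R') →
            -(711 / 500) + 1 / 6 * (16 / ((31 / 50) ^ 3 * R' ^ 3) + 18 / ((31 / 50) ^ 2 * R' ^ 4) +
                36 / (5 * (31 / 50) * R' ^ 5) + 1 / R' ^ 6 - ((N.card : ℝ) + 1) * R'⁻¹ ^ 6) <
              ∑ q ∈ N, lennardJones (dist p q)) :
    ∀ (Y : Set (EuclideanSpace ℝ (Fin 3))) (u : EuclideanSpace ℝ (Fin 3)), ‖u‖ = 1 →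
      (0 : EuclideanSpace ℝ (Fin 3)) ∈ Y →
      (∀ p ∈ Y, ∀ q ∈ Y, p ≠ q → 31 / 50 ≤ dist p q) →
      (∀ q ∈ Y, inner ℝ q u ≤ 0) →
      (∀ p ∈ Y, dist p 0 ≤ 6 → ∑' q : {q : EuclideanSpace ℝ (Fin 3) // q ∈ Y ∧ q ≠ p},
          lennardJones (dist p q.1) ≤ -(711 / 500)) →
      False := by
  obtain ⟨R', hR', hcert⟩ := H
  intro Y u hu h0 hsep hhalf hU
  exact local_of_finiteCert_credit_at (δ := 31 / 50) (r := 6) (Λ := -(711 / 500)) (by norm_num)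
    (by norm_num) hR' hcert Y u hu h0 hsep hhalf hU

end Summit.AtomisticToContinuum.Crystallization.Theorems.PerronTransitivityUniformBindingRigidity

end
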